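import Summits.Ventures.PercRepro.Night2StarIdentity

/-!
# PercRepro — `(★)`: the general counting bound `b(S) ≤ C(|S| − m(S), q − m(S))` (night-2's Lemma 3, count part)
(p3, offered to night-2's lane; imports `Night2StarIdentity` only)

Every basis of `G` inside a spanning set `S` contains every coloop of `M|S` (`coloopsOf_subset_of_mem_Bq`): a basis
missing the coloop `c` would lie in `S ∖ c`, whose rank is `ρ(S) − 1 < q`.  Hence `B ↦ B ∖ coloopsOf M S` injects the
bases inside `S` into the `(q − m(S))`-subsets of the cyclic part `S ∖ coloopsOf M S` (`|S| − m(S)` points), and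
**`bIn_le_choose`**: `b(S) ≤ C(|S| − m(S), q − m(S))`.  In night-2's notation (`S = B ∪ T`, `k_T = q − m(S_T)`,
`|S_T| − m(S_T) = k_T + |T|`): `b(S_T) ≤ C(k_T + |T|, k_T) = C(k_T + |T|, |T|)`.
-/
namespace PercRepro.Star

open Finset ThmH SixFour GenQ

variable {α : Type*} [DecidableEq α] {M : Matroid α} [M.Finite]

/-- A basis of `G` inside `S` contains every coloop of `M|S`. -/
theorem coloopsOf_subset_of_mem_Bq {G S B : Finset α} {q : ℕ} (hG : G ⊆ gr M) (hS : S ⊆ G)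
    (hr : M.eRk (S : Set α) = (q : ℕ∞)) (hB : B ∈ Bq M G q) (hBS : B ⊆ S) : coloopsOf M S ⊆ B := by
  intro c hc
  by_contra hcB
  have hcS : c ∈ S := (mem_coloopsOf.1 hc).1
  have hBS' : B ⊆ S.erase c := fun x hx => Finset.mem_erase.2 ⟨fun h => hcB (h ▸ hx), hBS hx⟩
  have hstep := eRk_erase_add_one_of_notMem_closure (hS.trans hG) hcS (mem_coloopsOf.1 hc).2
  have hle : M.eRk (B : Set α) ≤ M.eRk ((S.erase c : Finset α) : Set α) :=
    M.eRk_mono (Finset.coe_subset.2 hBS')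
  rw [(mem_Bq.1 hB).2.1] at hle
  obtain ⟨r, hr'⟩ := exists_eRk_eq_nat (M := M) (S.erase c)
  rw [hr', hr] at hstep
  rw [hr'] at hle
  have h1 : r + 1 = q := by exact_mod_cast hstep
  have h2 : q ≤ r := by exact_mod_cast hle
  omega

/-- **The counting bound**: `b(S) ≤ C(|S| − m(S), q − m(S))` — the bases inside a rank-`q` subset `S` of `G` inject
into the `(q − m(S))`-subsets of the cyclic part `S ∖ coloopsOf M S`. -/
theorem bIn_le_choose {G S : Finset α} {q : ℕ} (hG : G ⊆ gr M) (hS : S ⊆ G)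
    (hr : M.eRk (S : Set α) = (q : ℕ∞)) :
    bIn M G q S ≤ (S.card - mTr M S).choose (q - mTr M S) := by
  unfold bIn
  set C := coloopsOf M S with hC
  have hCS : C ⊆ S := coloopsOf_subset S
  have hcardC : C.card = mTr M S := rfl
  rw [← hcardC, ← Finset.card_sdiff_of_subset hCS, ← Finset.card_powersetCard]
  apply Finset.card_le_card_of_injOn (fun B => B \ C)
  · intro B hB
    have hB' := Finset.mem_filter.1 (Finset.mem_coe.1 hB)
    have hCB : C ⊆ B := coloopsOf_subset_of_mem_Bq hG hS hr hB'.1 hB'.2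
    show B \ C ∈ (Finset.powersetCard (q - C.card) (S \ C) : Set (Finset α))
    rw [Finset.mem_coe, Finset.mem_powersetCard]
    refine ⟨fun x hx => ?_, ?_⟩
    · have hx' := Finset.mem_sdiff.1 hx
      exact Finset.mem_sdiff.2 ⟨hB'.2 hx'.1, hx'.2⟩
    · rw [Finset.card_sdiff_of_subset hCB, (mem_Bq.1 hB'.1).2.2, hcardC]
  · intro B₁ hB₁ B₂ hB₂ h
    have h₁ := Finset.mem_filter.1 (Finset.mem_coe.1 hB₁)
    have h₂ := Finset.mem_filter.1 (Finset.mem_coe.1 hB₂)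
    have hC₁ : C ⊆ B₁ := coloopsOf_subset_of_mem_Bq hG hS hr h₁.1 h₁.2
    have hC₂ : C ⊆ B₂ := coloopsOf_subset_of_mem_Bq hG hS hr h₂.1 h₂.2
    have e₁ : B₁ = B₁ \ C ∪ C := (Finset.sdiff_union_of_subset hC₁).symm
    have e₂ : B₂ = B₂ \ C ∪ C := (Finset.sdiff_union_of_subset hC₂).symm
    rw [e₁, e₂]
    simp only at h
    rw [h]

/-- The cyclic part of a rank-`q` subset has `|S| − m(S)` points and rank `q − m(S)` (`eRk_sdiff_add_card_eq_of_subset_coloopsOf`). -/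
theorem eRk_sdiff_coloopsOf {S : Finset α} {q : ℕ} (hS : S ⊆ gr M) (hr : M.eRk (S : Set α) = (q : ℕ∞)) :
    M.eRk ((S \ coloopsOf M S : Finset α) : Set α) = ((q - mTr M S : ℕ) : ℕ∞) := by
  have h := eRk_sdiff_add_card_eq_of_subset_coloopsOf hS (coloopsOf M S) (Finset.Subset.refl _)
  rw [hr] at h
  obtain ⟨r, hr'⟩ := exists_eRk_eq_nat (M := M) (S \ coloopsOf M S)
  rw [hr'] at h ⊢
  have hrm : r + (coloopsOf M S).card = q := by exact_mod_cast h
  have : r = q - mTr M S := by unfold mTr; omega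
  rw [this]

end PercRepro.Star
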